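import Mathlib.Analysis.Normed.Algebra.MatrixExponential
import Mathlib.Topology.MetricSpace.Bounded
import Mathlib.Algebra.BigOperators.Finprod
import Literature.MathematicalPhysics.QuantumLattice.FinDimSpectrum
import Literature.MathematicalPhysics.QuantumLattice.SpinSystem
import Literature.MathematicalPhysics.QuantumLattice.LatticeTori
import Literature.Probability.LatticeModels.LatticeGraph
import Literature.Probability.LatticeModels.ThermodynamicLimit
import HarnessLib

-- provenance: harness21/H21/H21/Prelude/QLatticeAQFT/LocalDynamics.lean @ dfb519f (interim HEAD d8f2665); M5 mechanical rewrite
/-!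
# Interactions, local Hamiltonians and Heisenberg dynamics (trunk QLatticeAQFT, item Q5)

Notion `local_hamiltonian_dynamics`. Contents:

* **Heisenberg dynamics** of a finite quantum system with Hamiltonian `H : Matrix n n ℂ`:
  `heisenbergEvolution H t A = e^{itH} A e^{-itH}` (Mathlib's `NormedSpace.exp`), with the group /
  automorphism laws `heisenbergEvolution_zero/_add/_mul/_conjTranspose` and isometry
  `norm_heisenbergEvolution` (L²-operator norm).
* **Finite systems.** An interaction on a finite set of sites `Λ` is a map
  `Φ : Finset Λ → 𝔄_Λ` (`Interaction Λ q`); it is *local* (`Interaction.IsLocal`) when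
  `Φ X ∈ 𝔄_X` and `Φ X = Φ Xᴴ`. The local Hamiltonian is `H_{Λ'} = Σ_{X ⊆ Λ'} Φ X`
  (`localHamiltonian`); `interactionStrength Φ = sup_x Σ_{X ∋ x} ‖Φ X‖`.
* **Infinite lattice `ℤ^d`.** `LatticeInteraction d q := (X : Finset ℤ^d) → 𝔄_X` (a dependent
  function type: `𝔄_X = Matrix (X → Fin q) (X → Fin q) ℂ`), its restriction to a finite volume
  `LatticeInteraction.restrict Φ Λ : Interaction ↥Λ q`, and the predicates
  `HasFiniteRange`, `IsBounded`, `IsHermitian`, `IsTranslationInvariant`, `IsRotationInvariant`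
  (dot-namespaced under `LatticeInteraction`, outline §0 "Names"); the box Hamiltonians
  `boxHamiltonian Φ L` on `box d L = {-L, …, L}^d`.
* **Periodic boundary conditions.** `rectTorusInteraction Φ Ls` wraps a lattice interaction onto
  the rectangular torus `Π i, ℤ/(Ls i)ℤ` (item Q5a `LatticeTori`), `rectTorusHamiltonian`, and the
  cubic specialisations `torusInteraction Φ L : Interaction (TorusSite d L) q`, `torusHamiltonian`.
* **Frustration-freeness** `IsFrustrationFree Φ Λ'` (the ground energy of `H_{Λ'}` is the sum of the
  ground energies of the terms) and `IsProjectorInteraction`.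

## Sources

* B. Nachtergaele, R. Sims, *Lieb–Robinson bounds and the exponential clustering theorem*,
  Comm. Math. Phys. **265** (2006) 119–130, §2 (interactions `Φ`, local Hamiltonians
  `H_Λ = Σ_{X ⊆ Λ} Φ(X)`, Heisenberg dynamics `τ_t(A) = e^{itH} A e^{-itH}`, the norm `‖Φ‖`).
* O. Bratteli, D. W. Robinson, *Operator Algebras and Quantum Statistical Mechanics II* (2nd ed.,
  1997), §6.2.1 (interactions, translation invariance, finite range, `H_Λ`), §6.2.4.
* M. B. Hastings, *Lieb–Schultz–Mattis in higher dimensions*, Phys. Rev. B **69** (2004) 104431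
  (rectangular tori `L₁ × ⋯ × L_d` with periodic boundary conditions).
* S. Michalakis, J. Zwolak, *Stability of frustration-free Hamiltonians*, CMP **322** (2013), §2
  (frustration-free and projector interactions).

## Mathlib / design notes

* Mathlib search: `NormedSpace.exp` (no field argument at this pin), `Matrix.exp_add_of_commute`,
  `Metric.diam`, `Finset.powerset`, `finsum` are used. Mathlib has no interactions / local
  Hamiltonians / Heisenberg picture for matrix algebras (`rg -i "heisenberg|localHamiltonian|
  frustration"` finds nothing relevant), so everything below is new but thin.
* `Interaction` and `LatticeInteraction` are `def`s (not `abbrev`s) so that the dot-namespaced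
  predicates `Interaction.IsLocal`, `LatticeInteraction.IsTranslationInvariant`, … resolve by
  dot notation; the additive/module structure is transferred by `inferInstanceAs`.
* Regions are moved along embeddings with `finsetMapEquiv f s : ↥s ≃ ↥(s.map f)` (not in Mathlib
  for `Finset`; Mathlib has `Multiset.mapEquiv` and `Equiv.Set.image` only) and matrices on
  configuration spaces are transported with `Matrix.reindex (Equiv.arrowCongr e (Equiv.refl _))`,
  as in `QLattice.reindexOp`.
* Wrapping onto tori (`rectTorusInteraction`): the term of the torus interaction at `Y ⊆ 𝕋` is the
  sum, over the finite subsets `X ⊆ ℤ^d` with `proj X = Y`, `2 diam X < Ls i` for all `i` and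
  coordinatewise minimum in the fundamental domain `Π [0, Ls i)` (one representative per class
  modulo the period lattice), of `Φ X` pulled back along `proj|_X` (injective by the diameter
  bound). The sum is a `finsum`, hence has the **junk value** `0` if infinitely many such `X` carry
  a nonzero term, which cannot happen for finite-range `Φ` with `2 R < min Ls`. Terms of larger
  diameter are dropped, as in Hastings (2004).
-/

noncomputable section

open Matrix Complex Finset
open scoped Matrix.Norms.L2Operator

namespace Literature.MathematicalPhysics.QuantumLattice

open Literature.Probability.LatticeModels

/-! ### Heisenberg dynamics -/

section Dynamics

variable {n : Type*} [Fintype n] [DecidableEq n]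

/-- The Heisenberg evolution `τ_t(A) = e^{itH} A e^{-itH}` generated by the Hamiltonian `H`.
Nachtergaele–Sims (2006) §2, eq. (2.4); Bratteli–Robinson II §6.2.1. [cite: NachtergaeleSims2006] -/
def heisenbergEvolution (H : Matrix n n ℂ) (t : ℝ) (A : Matrix n n ℂ) : Matrix n n ℂ :=
  NormedSpace.exp ((I * t) • H) * A * NormedSpace.exp ((-(I * t)) • H)

/-- `τ_0 = id`. Bratteli–Robinson II §6.2.1. [folklore] -/
@[simp]
theorem heisenbergEvolution_zero (H A : Matrix n n ℂ) : heisenbergEvolution H 0 A = A := by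
  simp [heisenbergEvolution, NormedSpace.exp_zero]

/-- One-parameter group generated by `H`: `e^{aH} e^{bH} = e^{(a+b)H}` (the multiples of `H`
commute; Mathlib `Matrix.exp_add_of_commute`). [folklore] -/
theorem exp_smul_mul_exp_smul (H : Matrix n n ℂ) (a b : ℂ) :
    NormedSpace.exp (a • H) * NormedSpace.exp (b • H) = NormedSpace.exp ((a + b) • H) := by
  rw [add_smul, Matrix.exp_add_of_commute _ _ (((Commute.refl H).smul_left a).smul_right b)]

/-- `e^{aH} e^{-aH} = 1`. [folklore] -/
theorem exp_smul_mul_exp_neg_smul (H : Matrix n n ℂ) (a : ℂ) :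
    NormedSpace.exp (a • H) * NormedSpace.exp ((-a) • H) = 1 := by
  rw [exp_smul_mul_exp_smul, add_neg_cancel, zero_smul, NormedSpace.exp_zero]

/-- `e^{-aH} e^{aH} = 1`. [folklore] -/
theorem exp_neg_smul_mul_exp_smul (H : Matrix n n ℂ) (a : ℂ) :
    NormedSpace.exp ((-a) • H) * NormedSpace.exp (a • H) = 1 := by
  rw [exp_smul_mul_exp_smul, neg_add_cancel, zero_smul, NormedSpace.exp_zero]

/-- `H` commutes with `e^{cH}` (Mathlib `Commute.exp_right`). [folklore] -/
theorem commute_exp_smul_self (H : Matrix n n ℂ) (c : ℂ) : Commute H (NormedSpace.exp (c • H)) :=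
  ((Commute.refl H).smul_right c).exp_right

/-- Group law `τ_{s+t} = τ_s ∘ τ_t` (`e^{i(s+t)H} = e^{isH} e^{itH}`, `exp_smul_mul_exp_smul`).
Bratteli–Robinson II §6.2.1. [folklore] -/
theorem heisenbergEvolution_add (H : Matrix n n ℂ) (s t : ℝ) (A : Matrix n n ℂ) :
    heisenbergEvolution H (s + t) A = heisenbergEvolution H s (heisenbergEvolution H t A) := by
  have h1 : ((I * ↑(s + t)) • H : Matrix n n ℂ) = (I * s + I * t) • H := by
    push_cast; rw [mul_add]
  have h2 : ((-(I * ↑(s + t))) • H : Matrix n n ℂ) = (-(I * t) + -(I * s)) • H := by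
    push_cast; congr 1; ring
  simp only [heisenbergEvolution]
  rw [h1, h2, ← exp_smul_mul_exp_smul, ← exp_smul_mul_exp_smul]
  simp only [mul_assoc]

/-- `τ_t` is multiplicative: `τ_t(AB) = τ_t(A) τ_t(B)` (`e^{-itH} e^{itH} = 1` in the middle).
Bratteli–Robinson II §6.2.1. [folklore] -/
theorem heisenbergEvolution_mul (H : Matrix n n ℂ) (t : ℝ) (A B : Matrix n n ℂ) :
    heisenbergEvolution H t (A * B) = heisenbergEvolution H t A * heisenbergEvolution H t B := by
  have hVU := exp_neg_smul_mul_exp_smul H (I * t)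
  simp only [heisenbergEvolution]
  calc _ = NormedSpace.exp ((I * ↑t) • H) * A *
        (NormedSpace.exp ((-(I * ↑t)) • H) * NormedSpace.exp ((I * ↑t) • H)) * B *
          NormedSpace.exp ((-(I * ↑t)) • H) := by rw [hVU, mul_one, mul_assoc _ A B]
    _ = _ := by simp only [mul_assoc]

/-- `τ_t` is unital (`e^{itH} e^{-itH} = 1`). Bratteli–Robinson II §6.2.1. [folklore] -/
theorem heisenbergEvolution_one (H : Matrix n n ℂ) (t : ℝ) : heisenbergEvolution H t 1 = 1 := by
  rw [heisenbergEvolution, mul_one, exp_smul_mul_exp_neg_smul]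

/-- The Hamiltonian is a constant of motion: `τ_t(H) = H` (`H` commutes with `e^{itH}`, Mathlib
`Commute.exp_right`). Bratteli–Robinson II §6.2.1. [folklore] -/
theorem heisenbergEvolution_self (H : Matrix n n ℂ) (t : ℝ) : heisenbergEvolution H t H = H := by
  rw [heisenbergEvolution, ← (commute_exp_smul_self H _).eq, mul_assoc, exp_smul_mul_exp_neg_smul,
    mul_one]

/-- For Hermitian `H`, `τ_t` is a ⋆-map: `τ_t(A)ᴴ = τ_t(Aᴴ)` (`(e^{itH})ᴴ = e^{-itH}` by Mathlib
`Matrix.exp_conjTranspose`). Bratteli–Robinson II §6.2.1. [folklore] -/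
theorem heisenbergEvolution_conjTranspose {H : Matrix n n ℂ} (hH : H.IsHermitian) (t : ℝ)
    (A : Matrix n n ℂ) : (heisenbergEvolution H t A)ᴴ = heisenbergEvolution H t Aᴴ := by
  have hU : (NormedSpace.exp ((I * ↑t) • H))ᴴ = NormedSpace.exp ((-(I * ↑t)) • H) := by
    rw [← Matrix.exp_conjTranspose, conjTranspose_smul, hH.eq]
    congr 2
    simp
  have hV : (NormedSpace.exp ((-(I * ↑t)) • H))ᴴ = NormedSpace.exp ((I * ↑t) • H) := by
    rw [← Matrix.exp_conjTranspose, conjTranspose_smul, hH.eq]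
    congr 2
    simp
  rw [heisenbergEvolution, heisenbergEvolution, conjTranspose_mul, conjTranspose_mul, hU, hV,
    ← mul_assoc]

/-- For Hermitian `H`, `τ_t` is isometric for the operator norm: `‖τ_t(A)‖ = ‖A‖`.
Nachtergaele–Sims (2006) §2. [cite: NachtergaeleSims2006] -/
def norm_heisenbergEvolution : Prop :=
  ∀ {H : Matrix n n ℂ} (hH : H.IsHermitian) (t : ℝ) (A : Matrix n n ℂ),
    ‖heisenbergEvolution H t A‖ = ‖A‖

/-- For Hermitian `H` and a scalar `c` with `c̄ = -c` (e.g. `c = ±it`, `t ∈ ℝ`), `e^{cH}` is unitary: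
`(e^{cH})ᴴ = e^{c̄ H} = e^{-cH}` (Mathlib `Matrix.exp_conjTranspose`) and
`e^{-cH} e^{cH} = e^{cH} e^{-cH} = 1` (`exp_neg_smul_mul_exp_smul`, `exp_smul_mul_exp_neg_smul`).
Bratteli–Robinson II §6.2.1; Nachtergaele–Sims (2006) §2 (`τ_t` is a group of automorphisms). [folklore] -/
theorem exp_smul_mem_unitary {H : Matrix n n ℂ} (hH : H.IsHermitian) {c : ℂ} (hc : star c = -c) :
    NormedSpace.exp (c • H) ∈ unitary (Matrix n n ℂ) := by
  have hstar : star (NormedSpace.exp (c • H)) = NormedSpace.exp ((-c) • H) := by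
    rw [star_eq_conjTranspose, ← Matrix.exp_conjTranspose, conjTranspose_smul, hH.eq, hc]
  rw [Unitary.mem_iff, hstar]
  exact ⟨exp_neg_smul_mul_exp_smul H c, exp_smul_mul_exp_neg_smul H c⟩

/-- **Discharge of `norm_heisenbergEvolution`.** For Hermitian `H` the propagators `e^{itH}` and
`e^{-itH}` are unitary (`exp_smul_mem_unitary`, as `(it)̄ = -it`), and the `L²`-operator norm on
`Matrix n n ℂ` is a C⋆-norm (Mathlib's scoped `Matrix.instCStarRing`), which is invariant under
left and right multiplication by unitaries (Mathlib `CStarRing.norm_mem_unitary_mul`,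
`CStarRing.norm_mul_mem_unitary`); hence `‖e^{itH} A e^{-itH}‖ = ‖A‖`. This is the statement that
the Heisenberg dynamics `τ_t(A) = e^{itH} A e^{-itH}` is a one-parameter group of (*-)automorphisms
of `𝔄_V = 𝔅(𝓗_V)`, hence isometric, Nachtergaele–Sims, CMP **265** (2006), §2, display following
eq. for `H = Σ_X Φ(X)` (arXiv:math-ph/0506030 p. 4: "The dynamics of the model is the one-parameter
group of automorphisms `{τ_t}` defined by `τ_t(A) = e^{itH} A e^{-itH}`"; used there in the trivial
bound `‖[τ_t(A), B]‖ ≤ 2‖A‖‖B‖`). [cite: NachtergaeleSims2006, §2] -/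
theorem norm_heisenbergEvolution_holds : norm_heisenbergEvolution (n := n) := by
  intro H hH t A
  have hI : star (I * (t : ℂ)) = -(I * (t : ℂ)) := by simp
  have hU : NormedSpace.exp ((I * (t : ℂ)) • H) ∈ unitary (Matrix n n ℂ) :=
    exp_smul_mem_unitary hH hI
  have hV : NormedSpace.exp ((-(I * (t : ℂ))) • H) ∈ unitary (Matrix n n ℂ) :=
    exp_smul_mem_unitary hH (by rw [star_neg, hI])
  rw [heisenbergEvolution, CStarRing.norm_mul_mem_unitary _ hV, CStarRing.norm_mem_unitary_mul _ hU]

end Dynamics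

/-! ### Transport of regions and configuration matrices -/

/-- A finite set `s` is in bijection with its image under an embedding `f`:
`↥s ≃ ↥(s.map f)`, `x ↦ f x`. (Bookkeeping; Mathlib has the `Multiset`/`Set` analogues
`Multiset.mapEquiv`, `Equiv.Set.image` only.) Bratteli–Robinson II §6.2.1 (covariance). [folklore] -/
def finsetMapEquiv {α β : Type*} (f : α ↪ β) (s : Finset α) : ↥s ≃ ↥(s.map f) :=
  Equiv.ofBijective (fun x => ⟨f x, mem_map_of_mem f x.2⟩)
    ⟨fun x y h => Subtype.ext (f.injective (congrArg Subtype.val h)), fun y => by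
      obtain ⟨y, hy⟩ := y
      obtain ⟨x, hx, rfl⟩ := mem_map.1 hy
      exact ⟨⟨x, hx⟩, rfl⟩⟩

/-- `finsetMapEquiv` unfolded. Bratteli–Robinson II §6.2.1. [folklore] -/
@[simp]
theorem coe_finsetMapEquiv_apply {α β : Type*} (f : α ↪ β) (s : Finset α) (x : ↥s) :
    (finsetMapEquiv f s x : β) = f x := rfl

/-- Transport of a matrix on the configuration space `X → Fin q` along a bijection of regions
`e : X ≃ Y` (relabelling of sites), `Matrix.reindex` along `σ ↦ σ ∘ e⁻¹`.
Bratteli–Robinson II §6.2.1 (covariance). [folklore] -/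
def transportOp {X Y : Type*} {q : ℕ} (e : X ≃ Y) (A : Matrix (X → Fin q) (X → Fin q) ℂ) :
    Matrix (Y → Fin q) (Y → Fin q) ℂ :=
  Matrix.reindex (e.arrowCongr (Equiv.refl (Fin q))) (e.arrowCongr (Equiv.refl (Fin q))) A

/-- Transport of configuration matrices is additive. Bratteli–Robinson II §6.2.1. [folklore] -/
theorem transportOp_add {X Y : Type*} {q : ℕ} (e : X ≃ Y)
    (A B : Matrix (X → Fin q) (X → Fin q) ℂ) :
    transportOp e (A + B) = transportOp e A + transportOp e B :=
  congrFun (congrFun (Matrix.submatrix_add A B) _) _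

/-- Transport of configuration matrices commutes with the adjoint. Bratteli–Robinson II §6.2.1. [folklore] -/
theorem transportOp_conjTranspose {X Y : Type*} {q : ℕ} (e : X ≃ Y)
    (A : Matrix (X → Fin q) (X → Fin q) ℂ) :
    transportOp e Aᴴ = (transportOp e A)ᴴ := by
  simp [transportOp]

/-! ### Interactions and local Hamiltonians on a finite set of sites -/

/-- An *interaction* on a finite set of sites `Λ` with local dimension `q`: a map assigning to
every region `X ⊆ Λ` an observable `Φ X ∈ 𝔄_Λ` (meant to be supported on `X` and Hermitian, see
`Interaction.IsLocal`). A `def` (not an `abbrev`) so that dot-notation `Φ.IsLocal` resolves.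
Nachtergaele–Sims (2006) §2; Bratteli–Robinson II §6.2.1. [cite: NachtergaeleSims2006] -/
def Interaction (Λ : Type*) (q : ℕ) : Type _ := Finset Λ → Op Λ q

namespace Interaction

variable {Λ : Type*} {q : ℕ}

/-- Interactions form an additive group (pointwise). Bratteli–Robinson II §6.2.1. [folklore] -/
instance instAddCommGroup : AddCommGroup (Interaction Λ q) :=
  inferInstanceAs (AddCommGroup (Finset Λ → Op Λ q))

/-- Interactions form a complex vector space (pointwise). Bratteli–Robinson II §6.2.1. [folklore] -/
instance instModule : Module ℂ (Interaction Λ q) :=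
  inferInstanceAs (Module ℂ (Finset Λ → Op Λ q))

/-- Build an interaction from a function (identity; fixes the type). Nachtergaele–Sims (2006) §2. [cite: NachtergaeleSims2006] -/
def mk (Φ : Finset Λ → Op Λ q) : Interaction Λ q := Φ

/-- `mk` unfolded. Nachtergaele–Sims (2006) §2. [cite: NachtergaeleSims2006] -/
@[simp] theorem mk_apply (Φ : Finset Λ → Op Λ q) (X : Finset Λ) : mk Φ X = Φ X := rfl

/-- Pointwise addition of interactions. Bratteli–Robinson II §6.2.1. [folklore] -/
@[simp] theorem add_apply (Φ Ψ : Interaction Λ q) (X : Finset Λ) : (Φ + Ψ) X = Φ X + Ψ X := rfl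

/-- Pointwise scalar multiplication of interactions. Bratteli–Robinson II §6.2.1. [folklore] -/
@[simp] theorem smul_apply (c : ℂ) (Φ : Interaction Λ q) (X : Finset Λ) : (c • Φ) X = c • Φ X :=
  rfl

/-- The zero interaction. Bratteli–Robinson II §6.2.1. [folklore] -/
@[simp] theorem zero_apply (X : Finset Λ) : (0 : Interaction Λ q) X = 0 := rfl

variable [Fintype Λ] [DecidableEq Λ]

/-- A *local* interaction: every term `Φ X` is supported on `X` (`Φ X ∈ 𝔄_X`) and Hermitian.
Nachtergaele–Sims (2006) §2 ("`Φ(X)ᴴ = Φ(X) ∈ 𝔄_X`"); Bratteli–Robinson II §6.2.1. [cite: NachtergaeleSims2006] -/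
def IsLocal (Φ : Interaction Λ q) : Prop :=
  ∀ X, IsSupportedOn (Φ X) X ∧ (Φ X).IsHermitian

/-- The terms of a local interaction are supported on their regions. Nachtergaele–Sims (2006) §2. [cite: NachtergaeleSims2006] -/
theorem IsLocal.isSupportedOn {Φ : Interaction Λ q} (h : Φ.IsLocal) (X : Finset Λ) :
    IsSupportedOn (Φ X) X := (h X).1

/-- The terms of a local interaction are Hermitian. Nachtergaele–Sims (2006) §2. [cite: NachtergaeleSims2006] -/
theorem IsLocal.isHermitian {Φ : Interaction Λ q} (h : Φ.IsLocal) (X : Finset Λ) :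
    (Φ X).IsHermitian := (h X).2

end Interaction

section Finite

variable {Λ : Type*} {q : ℕ}

/-- The local Hamiltonian `H_{Λ'} = Σ_{X ⊆ Λ'} Φ X` of the interaction `Φ` in the region `Λ'`.
Nachtergaele–Sims (2006) §2, eq. (2.3); Bratteli–Robinson II §6.2.1, eq. (6.2.4). [cite: NachtergaeleSims2006] -/
def localHamiltonian (Φ : Interaction Λ q) (Λ' : Finset Λ) : Op Λ q :=
  ∑ X ∈ Λ'.powerset, Φ X

/-- The local Hamiltonian is additive in the interaction. Bratteli–Robinson II §6.2.1. [folklore] -/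
theorem localHamiltonian_add (Φ Ψ : Interaction Λ q) (Λ' : Finset Λ) :
    localHamiltonian (Φ + Ψ) Λ' = localHamiltonian Φ Λ' + localHamiltonian Ψ Λ' := by
  simp [localHamiltonian, sum_add_distrib]

variable [Fintype Λ] [DecidableEq Λ]

/-- A *projector interaction*: every term is an orthogonal projection (`Φ X = Φ Xᴴ = (Φ X)²`), the
normal form used in stability theory. Michalakis–Zwolak (2013) §2, Assumption. [cite: MichalakisZwolak2013] -/
def IsProjectorInteraction (Φ : Interaction Λ q) : Prop :=
  ∀ X, (Φ X).IsHermitian ∧ Φ X * Φ X = Φ X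

/-- The interaction norm `‖Φ‖ = sup_{x ∈ Λ} Σ_{X ∋ x} ‖Φ X‖` (operator norm). **Junk value** `0`
for empty `Λ` (`iSup` over an empty type). Nachtergaele–Sims (2006) §2, eq. (2.6) (with `λ = 0`
and without the `|X|` weight); Bratteli–Robinson II §6.2.1. [cite: NachtergaeleSims2006] -/
def interactionStrength (Φ : Interaction Λ q) : ℝ :=
  ⨆ x : Λ, ∑ X ∈ univ.filter (fun X : Finset Λ => x ∈ X), ‖Φ X‖

/-- The local Hamiltonian of a local interaction is Hermitian. Nachtergaele–Sims (2006) §2. [cite: NachtergaeleSims2006] -/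
theorem localHamiltonian_isHermitian {Φ : Interaction Λ q} (h : Φ.IsLocal) (Λ' : Finset Λ) :
    (localHamiltonian Φ Λ').IsHermitian := by
  unfold localHamiltonian
  rw [IsHermitian, conjTranspose_sum]
  exact sum_congr rfl fun X _ => (h.isHermitian X).eq

/-- The local Hamiltonian of a local interaction in `Λ'` is supported on `Λ'`.
Nachtergaele–Sims (2006) §2. [cite: NachtergaeleSims2006] -/
def localHamiltonian_isSupportedOn : Prop :=
  ∀ {Φ : Interaction Λ q} (h : Φ.IsLocal) (Λ' : Finset Λ),
    IsSupportedOn (localHamiltonian Φ Λ') Λ'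

/- interim proof relied on results that are now named facts (D-0014); demoted to a fact by the M5 import, proof preserved:
:=
  IsSupportedOn.sum _ fun X hX => (h.isSupportedOn X).mono (mem_powerset.1 hX)
-/

/-- **Frustration-freeness** of `Φ` on `Λ'`: the ground energy of `H_{Λ'} = Σ_{X ⊆ Λ'} Φ X` is the
sum of the ground energies of its terms, i.e. a ground state of `H_{Λ'}` minimises every term
simultaneously. Michalakis–Zwolak (2013) §2; Tasaki (2020) §7.1. [cite: MichalakisZwolak2013] -/
def IsFrustrationFree (Φ : Interaction Λ q) (Λ' : Finset Λ) : Prop :=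
  (localHamiltonian Φ Λ').groundEnergy = ∑ X ∈ Λ'.powerset, (Φ X).groundEnergy

/-- If every term has ground energy `0` (e.g. the terms are non-trivial projections),
frustration-freeness says `E₀(H_{Λ'}) = 0`. Michalakis–Zwolak (2013) §2. [cite: MichalakisZwolak2013] -/
theorem IsFrustrationFree.groundEnergy_eq_zero {Φ : Interaction Λ q} {Λ' : Finset Λ}
    (h : IsFrustrationFree Φ Λ') (h0 : ∀ X ∈ Λ'.powerset, (Φ X).groundEnergy = 0) :
    (localHamiltonian Φ Λ').groundEnergy = 0 := by
  rw [h]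
  exact sum_eq_zero h0

end Finite

/-! ### Interactions on the infinite lattice `ℤ^d` -/

/-- An interaction on the infinite lattice `ℤ^d` with local dimension `q`: to every finite region
`X ⊆ ℤ^d` an element `Φ X ∈ 𝔄_X = Matrix (X → Fin q) (X → Fin q) ℂ` (a dependent function type;
a `def` so that the dot-namespaced predicates below resolve). Bratteli–Robinson II §6.2.1,
Definition preceding (6.2.4); Nachtergaele–Sims (2006) §2. [cite: NachtergaeleSims2006] -/
def LatticeInteraction (d q : ℕ) : Type :=
  (X : Finset (Site d)) → Matrix (X → Fin q) (X → Fin q) ℂ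

namespace LatticeInteraction

variable {d q : ℕ}

/-- Lattice interactions form an additive group (pointwise). Bratteli–Robinson II §6.2.1. [folklore] -/
instance instAddCommGroup : AddCommGroup (LatticeInteraction d q) :=
  inferInstanceAs (AddCommGroup ((X : Finset (Site d)) → Matrix (X → Fin q) (X → Fin q) ℂ))

/-- Lattice interactions form a complex vector space (the space of interactions of
Bratteli–Robinson II §6.2.1, before imposing a norm). [folklore] -/
instance instModule : Module ℂ (LatticeInteraction d q) :=
  inferInstanceAs (Module ℂ ((X : Finset (Site d)) → Matrix (X → Fin q) (X → Fin q) ℂ))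

/-- Build a lattice interaction from a dependent function (identity; fixes the type).
Bratteli–Robinson II §6.2.1. [folklore] -/
def mk (Φ : (X : Finset (Site d)) → Matrix (X → Fin q) (X → Fin q) ℂ) : LatticeInteraction d q :=
  Φ

/-- `mk` unfolded. Bratteli–Robinson II §6.2.1. [folklore] -/
@[simp] theorem mk_apply (Φ : (X : Finset (Site d)) → Matrix (X → Fin q) (X → Fin q) ℂ)
    (X : Finset (Site d)) : mk Φ X = Φ X := rfl

/-- Pointwise addition. Bratteli–Robinson II §6.2.1. [folklore] -/
@[simp] theorem add_apply (Φ Ψ : LatticeInteraction d q) (X : Finset (Site d)) :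
    (Φ + Ψ) X = Φ X + Ψ X := rfl

/-- Pointwise scalar multiplication. Bratteli–Robinson II §6.2.1. [folklore] -/
@[simp] theorem smul_apply (c : ℂ) (Φ : LatticeInteraction d q) (X : Finset (Site d)) :
    (c • Φ) X = c • Φ X := rfl

/-- The zero interaction. Bratteli–Robinson II §6.2.1. [folklore] -/
@[simp] theorem zero_apply (X : Finset (Site d)) : (0 : LatticeInteraction d q) X = 0 := rfl

/-- Restriction of a lattice interaction to a finite volume `Λ ⊆ ℤ^d`, as an interaction of the
finite system on `↥Λ`: the term at `X ⊆ ↥Λ` is `Φ X ⊗ 𝟙_{Λ∖X}` (`localOp` of `Φ` at the image of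
`X` in `ℤ^d`, transported along `finsetMapEquiv`). Bratteli–Robinson II §6.2.1, eq. (6.2.4);
Nachtergaele–Sims (2006) §2. [cite: NachtergaeleSims2006] -/
def restrict (Φ : LatticeInteraction d q) (Λ : Finset (Site d)) : Interaction ↥Λ q :=
  Interaction.mk fun X =>
    localOp X (transportOp (finsetMapEquiv (Function.Embedding.subtype _) X).symm
      (Φ (X.map (Function.Embedding.subtype _))))

/-- `Φ` has *finite range* `R`: `Φ X = 0` whenever `diam X > R` (sup metric on `ℤ^d`).
Bratteli–Robinson II §6.2.1 ("finite range"); Nachtergaele–Sims (2006) §2. [cite: NachtergaeleSims2006] -/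
def HasFiniteRange (Φ : LatticeInteraction d q) (R : ℝ) : Prop :=
  ∀ X : Finset (Site d), R < Metric.diam (X : Set (Site d)) → Φ X = 0

/-- `Φ` is *bounded* by `J`: `‖Φ X‖ ≤ J` for every region (L²-operator norm).
Bratteli–Robinson II §6.2.1; Nachtergaele–Sims (2006) §2. [cite: NachtergaeleSims2006] -/
def IsBounded (Φ : LatticeInteraction d q) (J : ℝ) : Prop :=
  ∀ X : Finset (Site d), ‖Φ X‖ ≤ J

/-- `Φ` is *Hermitian*: every term is self-adjoint. Bratteli–Robinson II §6.2.1. [folklore] -/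
protected def IsHermitian (Φ : LatticeInteraction d q) : Prop :=
  ∀ X : Finset (Site d), (Φ X).IsHermitian

/-- `Φ` is *translation invariant*: `Φ (X + v) = τ_v (Φ X)` for every `v ∈ ℤ^d`, where the
translate `X + v = X.map (Site.shift v)` and `τ_v` transports along `x ↦ x + v`.
Bratteli–Robinson II §6.2.1, eq. (6.2.3). [folklore] -/
def IsTranslationInvariant (Φ : LatticeInteraction d q) : Prop :=
  ∀ (v : Site d) (X : Finset (Site d)),
    Φ (X.map (Site.shift v).toEmbedding) =
      transportOp (finsetMapEquiv (Site.shift v).toEmbedding X) (Φ X)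

/-- `Φ` (local dimension `n + 1 = 2S + 1`) is *rotation invariant* (global `SU(2)` symmetry):
every term commutes with the global rotation `⨂_{x ∈ X} exp(-i θ·𝐒_x)` of its region, for all
rotation vectors `θ`. Tasaki (2020) §2.2; Bratteli–Robinson II §6.2.1. [cite: Tasaki2020] -/
def IsRotationInvariant {n : ℕ} (Φ : LatticeInteraction d (n + 1)) : Prop :=
  ∀ (θ : Fin 3 → ℝ) (X : Finset (Site d)), Commute (Φ X) (globalRotation (Λ := ↥X) n θ)

/-- Restriction is additive. Bratteli–Robinson II §6.2.1. [folklore] -/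
theorem restrict_add (Φ Ψ : LatticeInteraction d q) (Λ : Finset (Site d)) :
    (Φ + Ψ).restrict Λ = Φ.restrict Λ + Ψ.restrict Λ := by
  funext X
  change localOp X _ = localOp X _ + localOp X _
  rw [← localOp_add, ← transportOp_add]
  rfl

/-- The restriction of a Hermitian lattice interaction is a local interaction of the finite
system. Bratteli–Robinson II §6.2.1. [folklore] -/
theorem IsHermitian.isLocal_restrict {Φ : LatticeInteraction d q} (h : Φ.IsHermitian)
    (Λ : Finset (Site d)) : (Φ.restrict Λ).IsLocal := by
  intro X
  refine ⟨isSupportedOn_localOp X _, ?_⟩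
  change (localOp X _)ᴴ = localOp X _
  rw [← localOp_conjTranspose, ← transportOp_conjTranspose, (h _).eq]

end LatticeInteraction

section Box

variable {d q : ℕ}

/-- The finite-volume Hamiltonian `H_L = Σ_{X ⊆ Λ_L} Φ X` of a lattice interaction in the box
`Λ_L = box d L = {-L, …, L}^d` (open boundary conditions), acting on `𝓗_{Λ_L}`.
Bratteli–Robinson II §6.2.1, eq. (6.2.4). [folklore] -/
def boxHamiltonian (Φ : LatticeInteraction d q) (L : ℕ) : Op ↥(box d L) q :=
  localHamiltonian (Φ.restrict (box d L)) univ

/-- The box Hamiltonian of a Hermitian interaction is Hermitian. Bratteli–Robinson II §6.2.1. [folklore] -/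
theorem boxHamiltonian_isHermitian {Φ : LatticeInteraction d q} (h : Φ.IsHermitian) (L : ℕ) :
    (boxHamiltonian Φ L).IsHermitian :=
  localHamiltonian_isHermitian (h.isLocal_restrict _) _

end Box

/-! ### Periodic boundary conditions: rectangular and cubic tori -/

section Torus

variable {d q : ℕ}

open Classical in
/-- Wrapping a term: the observable `A ∈ 𝔄_X`, `X ⊆ ℤ^d` finite, pushed to the rectangular torus
`𝕋 = Π i, ℤ/(Ls i)ℤ` along the projection `proj = RectTorus.proj Ls`; entrywise
`⟨σ| wrapTerm Ls X A |τ⟩ = A (σ ∘ proj|_X) (τ ∘ proj|_X)` if `σ = τ` off `proj X`, else `0`.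
When `proj` is injective on `X` this is `A` transported to `proj X ⊆ 𝕋` and tensored with the
identity elsewhere. (Classical decidability of the off-`proj X` condition: the torus need not be
finite here, sides `Ls i = 0` being allowed by the type.)
Hastings (2004) (periodic boundary conditions); Bratteli–Robinson II §6.2.1. [cite: Hastings2004] -/
def wrapTerm (Ls : Fin d → ℕ) (X : Finset (Site d)) (A : Matrix (X → Fin q) (X → Fin q) ℂ) :
    Op (RectTorusSite Ls) q :=
  of fun σ τ => if (∀ y, y ∉ X.image (RectTorus.proj Ls) → σ y = τ y) then
    A (fun x => σ (RectTorus.proj Ls x)) (fun x => τ (RectTorus.proj Ls x)) else 0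

/-- `X ⊆ ℤ^d` is the chosen representative of its class modulo the period lattice
`Π i, (Ls i)ℤ` among the regions that fit into the torus: `X` is nonempty, its coordinatewise
minimum lies in the fundamental domain `Π i, [0, Ls i)`, and `2 diam X < Ls i` for every `i`
(so that `RectTorus.proj Ls` is injective on `X` and `X` "does not feel" the periodicity).
Hastings (2004); cf. Nachtergaele–Sims (2006) §2. [cite: Hastings2004] -/
def IsWrapRepresentative (Ls : Fin d → ℕ) (X : Finset (Site d)) : Prop :=
  ∃ h : X.Nonempty, (∀ i, 0 ≤ X.inf' h (fun x => x i) ∧ X.inf' h (fun x => x i) < Ls i) ∧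
    ∀ i, 2 * Metric.diam (X : Set (Site d)) < Ls i

/-- The interaction induced by a lattice interaction `Φ` on the rectangular torus
`𝕋 = Π i, ℤ/(Ls i)ℤ` (periodic boundary conditions, Hastings (2004)): the term at `Y ⊆ 𝕋` is the
sum of the wrapped terms `wrapTerm Ls X (Φ X)` over the representatives `X ⊆ ℤ^d`
(`IsWrapRepresentative Ls X`) projecting onto `Y`. Terms of `Φ` with `2 diam X ≥ Ls i` for some `i`
are dropped. The sum is a `finsum`: **junk value** `0` if infinitely many representatives over `Y`
carry a nonzero term (impossible when `Φ` has finite range `R` with `2R < min_i Ls i`, the only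
case in which this construction is used). For translation-invariant `Φ` the choice of
representatives is immaterial. Hastings, PRB 69 (2004) 104431; Bratteli–Robinson II §6.2.1. [cite: Hastings2004] -/
def rectTorusInteraction (Φ : LatticeInteraction d q) (Ls : Fin d → ℕ) :
    Interaction (RectTorusSite Ls) q :=
  Interaction.mk fun Y =>
    ∑ᶠ (X : Finset (Site d)) (_ : IsWrapRepresentative Ls X ∧ X.image (RectTorus.proj Ls) = Y),
      wrapTerm Ls X (Φ X)

/-- The Hamiltonian `H_𝕋 = Σ_{Y ⊆ 𝕋} (rectTorusInteraction Φ Ls) Y` of `Φ` on the rectangular torus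
`Π i, ℤ/(Ls i)ℤ` with periodic boundary conditions (all sides nonzero).
Hastings, PRB 69 (2004) 104431. [folklore] -/
def rectTorusHamiltonian (Φ : LatticeInteraction d q) (Ls : Fin d → ℕ) [∀ i, NeZero (Ls i)] :
    Op (RectTorusSite Ls) q :=
  localHamiltonian (rectTorusInteraction Φ Ls) univ

/-- The interaction induced by `Φ` on the cubic torus `(ℤ/Lℤ)^d = StatMech.TorusSite d L`: the
rectangular case with constant sides (the types agree by `rfl`, cf. `rectTorusSite_const`).
Nachtergaele–Sims (2006) §2; Hastings (2004). [cite: NachtergaeleSims2006] -/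
def torusInteraction (Φ : LatticeInteraction d q) (L : ℕ) : Interaction (TorusSite d L) q :=
  rectTorusInteraction Φ (fun _ => L)

/-- The Hamiltonian of `Φ` on the cubic torus `(ℤ/Lℤ)^d` with periodic boundary conditions
(`L ≠ 0`). Nachtergaele–Sims (2006) §2; Hastings (2004). [cite: NachtergaeleSims2006] -/
def torusHamiltonian (Φ : LatticeInteraction d q) (L : ℕ) [NeZero L] : Op (TorusSite d L) q :=
  localHamiltonian (torusInteraction Φ L) univ

/-- The cubic torus Hamiltonian is the rectangular one with constant sides (definitional).
Hastings (2004). [cite: Hastings2004] -/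
theorem torusHamiltonian_eq_rectTorusHamiltonian (Φ : LatticeInteraction d q) (L : ℕ) [NeZero L] :
    torusHamiltonian Φ L = rectTorusHamiltonian Φ (fun _ : Fin d => L) := rfl

/-- A wrapped term is supported on the projection of its region: `wrapTerm Ls X A` is `localOp` of
the matrix `(σ, τ) ↦ A (σ ∘ proj|_X) (τ ∘ proj|_X)` on the region `proj X ⊆ 𝕋` (definitional up
to the decidability instance of the off-region condition). Bratteli–Robinson II §6.2.1. [folklore] -/
theorem isSupportedOn_wrapTerm (Ls : Fin d → ℕ) [∀ i, NeZero (Ls i)] (X : Finset (Site d))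
    (A : Matrix (X → Fin q) (X → Fin q) ℂ) :
    IsSupportedOn (wrapTerm Ls X A) (X.image (RectTorus.proj Ls)) := by
  classical
  refine ⟨fun σ τ => A (fun x => σ ⟨RectTorus.proj Ls x, mem_image_of_mem _ x.2⟩)
    (fun x => τ ⟨RectTorus.proj Ls x, mem_image_of_mem _ x.2⟩), ?_⟩
  ext σ τ
  simp only [localOp, wrapTerm, of_apply]
  split_ifs <;> rfl

/-- Wrapping commutes with the adjoint. Bratteli–Robinson II §6.2.1. [folklore] -/
theorem wrapTerm_conjTranspose (Ls : Fin d → ℕ) (X : Finset (Site d))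
    (A : Matrix (X → Fin q) (X → Fin q) ℂ) :
    wrapTerm Ls X Aᴴ = (wrapTerm Ls X A)ᴴ := by
  classical
  ext σ τ
  simp only [wrapTerm, of_apply, conjTranspose_apply]
  have h : (∀ y, y ∉ X.image (RectTorus.proj Ls) → σ y = τ y) ↔
      (∀ y, y ∉ X.image (RectTorus.proj Ls) → τ y = σ y) :=
    forall_congr' fun y => imp_congr_right fun _ => eq_comm
  rw [if_congr h rfl rfl]
  split_ifs <;> simp

/-- The torus interaction of a Hermitian lattice interaction is local (supported and Hermitian
terms). Bratteli–Robinson II §6.2.1; Hastings (2004). [cite: Hastings2004] -/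
def rectTorusInteraction_isLocal : Prop :=
  ∀ {Φ : LatticeInteraction d q} (h : Φ.IsHermitian) (Ls : Fin d → ℕ) [∀ i, NeZero (Ls i)],
    (rectTorusInteraction Φ Ls).IsLocal

/-- The torus Hamiltonian of a Hermitian lattice interaction is Hermitian.
Bratteli–Robinson II §6.2.1. [folklore] -/
def rectTorusHamiltonian_isHermitian : Prop :=
  ∀ {Φ : LatticeInteraction d q} (h : Φ.IsHermitian) (Ls : Fin d → ℕ) [∀ i, NeZero (Ls i)],
    (rectTorusHamiltonian Φ Ls).IsHermitian

/- interim proof relied on results that are now named facts (D-0014); demoted to a fact by the M5 import, proof preserved: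
:=
  localHamiltonian_isHermitian (rectTorusInteraction_isLocal h Ls) _
-/

end Torus

end Literature.MathematicalPhysics.QuantumLattice
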